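import Mathlib.AlgebraicGeometry.EllipticCurve.Reduction
import Mathlib.Algebra.Polynomial.Degree.SmallDegree
import Literature.RingTheory.DiscreteValuationRing.AdicCompletionHensel
import Literature.NumberTheory.DiophantineGeometry.TateAlgorithmProofs
import Literature.NumberTheory.DiophantineGeometry.LocalReductionProofs
import HarnessLib

/-!
# The normal form `y² + xy = x³ + a₆` of a split multiplicative Weierstrass equation

Second file of the series proving the named fact
`Literature.NumberTheory.EllipticCurves.rationalComponents_eq_card_of_hasSplitMultiplicativeReductionAt` (`NeronModel`,
`NeronModelProofs`): the local minimal model of an elliptic curve at a place `v` of split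
multiplicative reduction can be brought, by a change of variables *defined over `O_v`*
(`u ∈ O_vˣ`, `r, s, t ∈ O_v`), to the shape of the Tate curve
`y² + xy = x³ + a₆`, `ord_v(a₆) = ord_v(Δ_min) ≥ 1`
(Silverman, *ATAEC*, V.3.1 and Rem. IV.9.6 obtain `E ≅ E_q : y² + xy = x³ + a₄(q)x + a₆(q)`,
`v(q) = v(Δ)`, from Tate's uniformisation; here the normal form is reached by elementary
changes of variables and Hensel's lemma, without `q`-expansions, and with `a₄ = 0`).

## Contents

* Part 1 (any field `k`): `WeierstrassCurve.exists_variableChange_eq_nodeNormalForm` — a nodal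
  cubic (`Δ = 0`, `c₄ ≠ 0`) with a `k`-rational tangent slope at the node (a root in `k` of the
  node-tangent polynomial `c₄T² + a₁c₄T − (54b₆ − 3b₂b₄ + a₂c₄)` of Mathlib's
  `WeierstrassCurve.HasSplitMultiplicativeReduction`) becomes `y² + a₁xy = x³`, `a₁ ≠ 0`, after
  a change of variables `⟨1, r, s, t⟩` over `k` (Silverman, *ATAEC*, IV.9.4, Step 2: "make a
  change of variables to move the singular point to `(0, 0)`"). The node's abscissa is
  `x₀ = (18b₆ − b₂b₄)/c₄` (docstring of `HasSplitMultiplicativeReduction`); that this point is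
  singular is derived, uniformly in the characteristic, from two explicit integer polynomial
  identities `b₄c₄² ∈ (18b₆ − b₂b₄, Δ)`, `b₈c₄² ∈ (18b₆ − b₂b₄, Δ)` in `ℤ[a₁, a₃, a₄, a₆]`
  (`b₄_mul_c₄_sq_eq_of_a₂_eq_zero`, `b₈_mul_c₄_sq_eq_of_a₂_eq_zero`, certificates found with
  Macaulay2, verified by `ring`).
* Part 2 (Henselian local ring `R`): `WeierstrassCurve.exists_variableChange_eq_tateNormalForm` —
  if the reduction of `I / R` is such a nodal cubic, an `R`-integral change of variables gives
  `y² + xy = x³ + a₆` with `a₆ ∈ 𝔪` (lift Part 1, rescale by the unit `a₁`, then two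
  applications of Hensel's lemma — the non-monic one of
  `Literature.RingTheory.DiscreteValuationRing.AdicCompletionHensel` for
  `12t² + (12a₃ − 4a₂ − 1)t + (a₄ − 2a₂a₃ + 3a₃²) = 0`, and a monic one for `s² + s = a₂`).
* Part 3 (`O_v`): `WeierstrassCurve.exists_variableChange_localMinimalIntegralModel_eq_tateNormalForm`
  (and its `K_v`-form `WeierstrassCurve.exists_variableChange_localMinimalModel_eq_tateNormalForm`) —
  for `W` elliptic with split multiplicative reduction at `v` and a uniformiser `ϖ`,
  `D • (W.localMinimalIntegralModel v) = (y² + xy = x³ + αϖⁿ)` with `D` over `O_v`, `α ∈ O_vˣ`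
  and `n = W.ordMinimalDiscriminant v ≥ 1` (`Δ = −a₆(1 + 432a₆)` for the normal form).

All declarations are deliberate dot-notation extensions of the Mathlib namespace
`WeierstrassCurve` (they are statements about `W : WeierstrassCurve _`).

## References

* J. H. Silverman, *Advanced Topics in the Arithmetic of Elliptic Curves*, GTM 151, 1994:
  Tate's algorithm IV.9.4, Step 2 (PDF p. 344); Rem. IV.9.6 (PDF p. 355); V.3, Thm. 3.1 and
  Rem. 3.1.2 (PDF pp. 394–395).
* J. H. Silverman, *The Arithmetic of Elliptic Curves*, 2nd ed., GTM 106, 2009, III.1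
  (Table 3.1: transformation formulae), VII.5 (split multiplicative reduction).
-/

noncomputable section

namespace WeierstrassCurve

/-! ### Part 1 — two integer identities and the node normal form over a field -/

section Identities

variable {S : Type*} [CommRing S] (W : WeierstrassCurve S)

/-- For a Weierstrass equation with `a₂ = 0`, the identity
`b₄ c₄² = P · (18 b₆ − b₂ b₄) − 72 Δ` with
`P = −a₁⁶ + 30 a₁³ a₃ + 60 a₁² a₄ − 108 a₃² − 432 a₆` (an identity in `ℤ[a₁, a₃, a₄, a₆]`,
found with Macaulay2 and checked by `ring`). It shows that a cubic with `Δ = 0`, `c₄ ≠ 0`,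
`a₂ = 0` and `18 b₆ = b₂ b₄` (node on the `y`-axis) has `b₄ = 0`. [folklore] -/
theorem b₄_mul_c₄_sq_eq_of_a₂_eq_zero (h2 : W.a₂ = 0) :
    W.b₄ * W.c₄ ^ 2 =
      (-W.a₁ ^ 6 + 30 * W.a₁ ^ 3 * W.a₃ + 60 * W.a₁ ^ 2 * W.a₄ - 108 * W.a₃ ^ 2
          - 432 * W.a₆) * (18 * W.b₆ - W.b₂ * W.b₄) + (-72) * W.Δ := by
  obtain ⟨a₁, a₂, a₃, a₄, a₆⟩ := W
  simp only at h2
  subst h2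
  simp only [b₂, b₄, b₆, b₈, c₄, Δ]
  ring

/-- For a Weierstrass equation with `a₂ = 0`, the identity `b₈ c₄² = P · (18 b₆ − b₂ b₄) + Q · Δ`
with `P = −a₁⁴a₃² + 2a₁³a₃a₄ − 6a₁⁴a₆ + 27a₁a₃³ + 2a₁²a₄² + 54a₃²a₄ + 108a₁a₃a₆ + 216a₄a₆` and
`Q = −a₁⁴ + 18a₁a₃ + 36a₄` (an identity in `ℤ[a₁, a₃, a₄, a₆]`, found with Macaulay2 and
checked by `ring`): with `Δ = 0`, `c₄ ≠ 0`, `18 b₆ = b₂ b₄` it gives `b₈ = 0`. [folklore] -/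
theorem b₈_mul_c₄_sq_eq_of_a₂_eq_zero (h2 : W.a₂ = 0) :
    W.b₈ * W.c₄ ^ 2 =
      (-W.a₁ ^ 4 * W.a₃ ^ 2 + 2 * W.a₁ ^ 3 * W.a₃ * W.a₄ - 6 * W.a₁ ^ 4 * W.a₆
          + 27 * W.a₁ * W.a₃ ^ 3 + 2 * W.a₁ ^ 2 * W.a₄ ^ 2 + 54 * W.a₃ ^ 2 * W.a₄
          + 108 * W.a₁ * W.a₃ * W.a₆ + 216 * W.a₄ * W.a₆) * (18 * W.b₆ - W.b₂ * W.b₄)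
        + (-W.a₁ ^ 4 + 18 * W.a₁ * W.a₃ + 36 * W.a₄) * W.Δ := by
  obtain ⟨a₁, a₂, a₃, a₄, a₆⟩ := W
  simp only at h2
  subst h2
  simp only [b₂, b₄, b₆, b₈, c₄, Δ]
  ring

/-- With `a₂ = 0` one has `c₄ = a₁⁴ − 24 b₄`. [folklore] -/
theorem c₄_eq_of_a₂_eq_zero (h2 : W.a₂ = 0) : W.c₄ = W.a₁ ^ 4 - 24 * W.b₄ := by
  simp only [c₄, b₂, b₄, h2]
  ring

/-- Under a translation `x = x' + r` the quantity `18 b₆ − b₂ b₄` (which is `c₄ · x₀` for the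
abscissa `x₀` of the singular point of a nodal cubic, cf. the docstring of Mathlib's
`WeierstrassCurve.HasSplitMultiplicativeReduction`) transforms as
`18 b₆' − b₂' b₄' = (18 b₆ − b₂ b₄) − r c₄`, i.e. `x₀' = x₀ − r`. [folklore] -/
theorem variableChange_nodeX (r : S) :
    18 * ((⟨1, r, 0, 0⟩ : VariableChange S) • W).b₆
        - ((⟨1, r, 0, 0⟩ : VariableChange S) • W).b₂ * ((⟨1, r, 0, 0⟩ : VariableChange S) • W).b₄ =
      (18 * W.b₆ - W.b₂ * W.b₄) - r * W.c₄ := by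
  simp only [variableChange_b₂, variableChange_b₄, variableChange_b₆, c₄, inv_one, Units.val_one,
    one_pow, one_mul]
  ring

end Identities

section Field

variable {k : Type*} [Field k] (W : WeierstrassCurve k)

/-- **Node normal form over a field.** Let `W` be a Weierstrass cubic over a field `k` with
`Δ = 0` and `c₄ ≠ 0` (a nodal cubic) whose node-tangent polynomial
`c₄ T² + a₁ c₄ T − (54 b₆ − 3 b₂ b₄ + a₂ c₄)` (Mathlib's
`WeierstrassCurve.HasSplitMultiplicativeReduction`; its roots are the slopes of the tangents at
the node) has a root `μ ∈ k`. Then a change of variables `⟨1, r, s, t⟩` over `k` brings `W` to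
the form `y² + a₁ xy = x³` with `a₁ ≠ 0`, i.e. `a₂ = a₃ = a₄ = a₆ = 0`: the node is moved to the
origin and its tangents to `y = 0`, `y = −a₁ x` (Silverman, *AEC*, III.1, proof of Prop. 1.4(a)
for the shape of a node; *ATAEC*, IV.9.4, Step 2: "make a change of variables to move the
singular point to `(0, 0)`"). Construction: shear `s = μ` (a tangent slope becomes `0`);
translate `r = (18 b₆ − b₂ b₄)/c₄` (then `x₀ = 0` and, from `f(μ) = 0`, `a₂ = 0`); the integer
identities `b₄_mul_c₄_sq_eq_of_a₂_eq_zero`, `b₈_mul_c₄_sq_eq_of_a₂_eq_zero` then force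
`b₄ = b₈ = 0`, so `c₄ = a₁⁴ ≠ 0` and `t = a₄/a₁` kills `a₃, a₄, a₆`. All in `k`, in every
characteristic. [cite: SilvermanATAEC1994, IV.9.4 Step 2 (PDF p. 344)] -/
theorem exists_variableChange_eq_nodeNormalForm (hΔ : W.Δ = 0) (hc₄ : W.c₄ ≠ 0) {μ : k}
    (hμ : W.c₄ * μ ^ 2 + W.a₁ * W.c₄ * μ - (54 * W.b₆ - 3 * W.b₂ * W.b₄ + W.a₂ * W.c₄) = 0) :
    ∃ C : VariableChange k, C.u = 1 ∧ (C • W).a₁ ≠ 0 ∧ (C • W).a₂ = 0 ∧ (C • W).a₃ = 0 ∧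
      (C • W).a₄ = 0 ∧ (C • W).a₆ = 0 := by
  -- Step 1: shear by `μ`
  set C₁ : VariableChange k := ⟨1, 0, μ, 0⟩ with hC₁
  set W₁ := C₁ • W with hW₁
  have h1b₂ : W₁.b₂ = W.b₂ := by
    simp only [hW₁, hC₁, variableChange_b₂, inv_one, Units.val_one, one_pow, one_mul, mul_zero,
      add_zero]
  have h1b₄ : W₁.b₄ = W.b₄ := by
    simp only [hW₁, hC₁, variableChange_b₄, inv_one, Units.val_one, one_pow, one_mul, zero_mul,
      add_zero, mul_zero, zero_pow two_ne_zero]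
  have h1b₆ : W₁.b₆ = W.b₆ := by
    simp only [hW₁, hC₁, variableChange_b₆, inv_one, Units.val_one, one_pow, one_mul]
    ring
  have h1c₄ : W₁.c₄ = W.c₄ := by
    simp only [hW₁, hC₁, variableChange_c₄, inv_one, Units.val_one, one_pow, one_mul]
  have h1Δ : W₁.Δ = 0 := by
    simp only [hW₁, hC₁, variableChange_Δ, inv_one, Units.val_one, one_pow, one_mul, hΔ]
  have h1a₂ : W₁.a₂ * W.c₄ = -(54 * W.b₆ - 3 * W.b₂ * W.b₄) := by
    simp only [hW₁, hC₁, variableChange_a₂, inv_one, Units.val_one, one_pow, one_mul, mul_zero,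
      add_zero]
    linear_combination -hμ
  -- Step 2: translate by `r = x₀`
  set r : k := (18 * W.b₆ - W.b₂ * W.b₄) / W.c₄ with hr
  have hr' : r * W.c₄ = 18 * W.b₆ - W.b₂ * W.b₄ := by
    rw [hr, div_mul_cancel₀ _ hc₄]
  set C₂ : VariableChange k := ⟨1, r, 0, 0⟩ with hC₂
  set W₂ := C₂ • W₁ with hW₂
  have h2a₂ : W₂.a₂ = 0 := by
    have : W₂.a₂ * W.c₄ = 0 := by
      have e : W₂.a₂ = W₁.a₂ + 3 * r := by
        simp only [hW₂, hC₂, variableChange_a₂, inv_one, Units.val_one, one_pow, one_mul,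
          zero_mul, sub_zero, zero_pow two_ne_zero]
      rw [e, add_mul, h1a₂]
      linear_combination 3 * hr'
    exact (mul_eq_zero.mp this).resolve_right hc₄
  have h2x₀ : 18 * W₂.b₆ - W₂.b₂ * W₂.b₄ = 0 := by
    rw [hW₂, hC₂, variableChange_nodeX, h1b₂, h1b₄, h1b₆, h1c₄, hr']
    ring
  have h2c₄ : W₂.c₄ = W.c₄ := by
    simp only [hW₂, hC₂, variableChange_c₄, inv_one, Units.val_one, one_pow, one_mul, h1c₄]
  have h2Δ : W₂.Δ = 0 := by
    simp only [hW₂, hC₂, variableChange_Δ, inv_one, Units.val_one, one_pow, one_mul, h1Δ]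
  -- the identities: `b₄ = b₈ = 0`, hence `c₄ = a₁⁴` and `a₁ ≠ 0`
  have h2b₄ : W₂.b₄ = 0 := by
    have e := W₂.b₄_mul_c₄_sq_eq_of_a₂_eq_zero h2a₂
    rw [h2x₀, h2Δ, mul_zero, mul_zero, add_zero] at e
    exact (mul_eq_zero.mp e).resolve_right (pow_ne_zero 2 (h2c₄ ▸ hc₄))
  have h2b₈ : W₂.b₈ = 0 := by
    have e := W₂.b₈_mul_c₄_sq_eq_of_a₂_eq_zero h2a₂
    rw [h2x₀, h2Δ, mul_zero, mul_zero, add_zero] at e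
    exact (mul_eq_zero.mp e).resolve_right (pow_ne_zero 2 (h2c₄ ▸ hc₄))
  have h2a₁ : W₂.a₁ ≠ 0 := by
    intro h0
    apply hc₄
    rw [← h2c₄, W₂.c₄_eq_of_a₂_eq_zero h2a₂, h2b₄, h0]
    ring
  -- Step 3: translate `y` by `t = a₄ / a₁`
  set t : k := W₂.a₄ / W₂.a₁ with ht
  have ht' : t * W₂.a₁ = W₂.a₄ := by rw [ht, div_mul_cancel₀ _ h2a₁]
  set C₃ : VariableChange k := ⟨1, 0, 0, t⟩ with hC₃
  refine ⟨C₃ * C₂ * C₁, ?_, ?_, ?_, ?_, ?_, ?_⟩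
  · simp [hC₁, hC₂, hC₃, VariableChange.mul_def]
  all_goals rw [mul_smul, mul_smul, ← hW₁, ← hW₂]
  · simpa only [hC₃, variableChange_a₁, inv_one, Units.val_one, one_mul, mul_zero, add_zero]
      using h2a₁
  · simp only [hC₃, variableChange_a₂, inv_one, Units.val_one, one_pow, zero_mul, sub_zero,
      mul_zero, add_zero, zero_pow two_ne_zero, h2a₂]
  · -- `a₃ + 2t = b₄ / a₁ = 0`
    have e : (W₂.a₃ + 2 * t) * W₂.a₁ = W₂.b₄ := by
      simp only [b₄]
      linear_combination 2 * ht'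
    rw [h2b₄] at e
    have e' := (mul_eq_zero.mp e).resolve_right h2a₁
    simpa only [hC₃, variableChange_a₃, inv_one, Units.val_one, one_pow, one_mul, zero_mul,
      add_zero] using e'
  · simp only [hC₃, variableChange_a₄, inv_one, Units.val_one, one_pow, one_mul, zero_mul,
      sub_zero, mul_zero, add_zero, zero_pow two_ne_zero]
    linear_combination -ht'
  · -- `a₆ - t a₃ - t² = b₈ / a₁² = 0`
    have e : (W₂.a₆ - t * W₂.a₃ - t ^ 2) * W₂.a₁ ^ 2 = W₂.b₈ := by
      simp only [b₈, h2a₂]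
      linear_combination (-(t * W₂.a₁) - W₂.a₄ - W₂.a₁ * W₂.a₃) * ht'
    rw [h2b₈] at e
    have e' := (mul_eq_zero.mp e).resolve_right (pow_ne_zero 2 h2a₁)
    simpa only [hC₃, variableChange_a₆, inv_one, Units.val_one, one_pow, one_mul, zero_mul,
      add_zero, zero_pow three_ne_zero, mul_zero, sub_zero, zero_pow two_ne_zero] using e'

end Field

/-! ### Part 2 — the normal form `y² + xy = x³ + a₆`, `a₆ ∈ 𝔪`, over a Henselian local ring -/

section Henselian

open IsLocalRing Polynomial

variable {R : Type*} [CommRing R] [HenselianLocalRing R] (I : WeierstrassCurve R)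

/-- **Normal form of a split multiplicative Weierstrass equation over a Henselian local ring.**
Let `I` be a Weierstrass equation over a Henselian local ring `R` whose reduction is a nodal
cubic (`Δ ∈ 𝔪`, `c₄ ∉ 𝔪`) with a rational tangent slope at the node (the node-tangent
polynomial of Mathlib's `HasSplitMultiplicativeReduction` has a root in the residue field). Then
an `R`-integral change of variables `D` (with `u ∈ Rˣ`) transforms `I` into
`y² + xy = x³ + a₆` with `a₆ ∈ 𝔪` (Silverman, *ATAEC*, V.3, the shape of the Tate curve
`y² + xy = x³ + a₄ x + a₆`, and IV.9.4, Step 2; here `a₄` is removed as well). Construction: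
lift the change of variables of `exists_variableChange_eq_nodeNormalForm` from the residue field
(then `a₁ ∈ Rˣ`, `a₂, a₃, a₄, a₆ ∈ 𝔪`), rescale by `u = a₁`, solve
`12t² + (12a₃ − 4a₂ − 1)t + (a₄ − 2a₂a₃ + 3a₃²) = 0` by the non-monic Hensel lemma
(`HenselianLocalRing.exists_isRoot_of_isUnit_derivative`) and translate by `⟨1, −a₃ − 2t, 0, t⟩`
to get `a₃ = a₄ = 0`, solve `s² + s = a₂` (monic Hensel) and shear to get `a₂ = 0`, and finally
rescale by the unit `1 + 2s`. [cite: SilvermanATAEC1994, IV.9.4 Step 2 (PDF p. 344)] -/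
theorem exists_variableChange_eq_tateNormalForm (hΔ : I.Δ ∈ maximalIdeal R)
    (hc₄ : I.c₄ ∉ maximalIdeal R)
    (hsplit : ∃ μ : ResidueField R, letI Ib := I.map (residue R);
      Ib.c₄ * μ ^ 2 + Ib.a₁ * Ib.c₄ * μ - (54 * Ib.b₆ - 3 * Ib.b₂ * Ib.b₄ + Ib.a₂ * Ib.c₄) = 0) :
    ∃ D : VariableChange R, (D • I).a₁ = 1 ∧ (D • I).a₂ = 0 ∧ (D • I).a₃ = 0 ∧ (D • I).a₄ = 0 ∧
      (D • I).a₆ ∈ maximalIdeal R := by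
  obtain ⟨μ, hμ⟩ := hsplit
  -- Step 1: normal form over the residue field, lifted to `R`
  have hΔb : (I.map (residue R)).Δ = 0 := by rw [map_Δ, residue_eq_zero_iff]; exact hΔ
  have hc₄b : (I.map (residue R)).c₄ ≠ 0 := by
    rw [map_c₄, Ne, residue_eq_zero_iff]; exact hc₄
  obtain ⟨Cb, hCu, hb₁, hb₂, hb₃, hb₄, hb₆⟩ :=
    (I.map (residue R)).exists_variableChange_eq_nodeNormalForm hΔb hc₄b hμ
  obtain ⟨r, hr⟩ := residue_surjective Cb.r
  obtain ⟨s, hs⟩ := residue_surjective Cb.s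
  obtain ⟨t, ht⟩ := residue_surjective Cb.t
  set D₁ : VariableChange R := ⟨1, r, s, t⟩ with hD₁
  have hD₁map : D₁.map (residue R) = Cb := by
    ext
    · simp [hD₁, VariableChange.map, hCu]
    · simpa [hD₁, VariableChange.map] using hr
    · simpa [hD₁, VariableChange.map] using hs
    · simpa [hD₁, VariableChange.map] using ht
  set I₁ := D₁ • I with hI₁
  have hI₁map : I₁.map (residue R) = Cb • I.map (residue R) := by
    rw [hI₁, ← map_variableChange, hD₁map]
  have h1a₁ : IsUnit I₁.a₁ := by
    rw [← residue_ne_zero_iff_isUnit, ← map_a₁, hI₁map]; exact hb₁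
  have h1a₂ : I₁.a₂ ∈ maximalIdeal R := by
    rw [← residue_eq_zero_iff, ← map_a₂, hI₁map]; exact hb₂
  have h1a₃ : I₁.a₃ ∈ maximalIdeal R := by
    rw [← residue_eq_zero_iff, ← map_a₃, hI₁map]; exact hb₃
  have h1a₄ : I₁.a₄ ∈ maximalIdeal R := by
    rw [← residue_eq_zero_iff, ← map_a₄, hI₁map]; exact hb₄
  have h1a₆ : I₁.a₆ ∈ maximalIdeal R := by
    rw [← residue_eq_zero_iff, ← map_a₆, hI₁map]; exact hb₆
  -- Step 2: rescale by `u = a₁`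
  set u : Rˣ := h1a₁.unit with hu
  have huval : (u : R) = I₁.a₁ := h1a₁.unit_spec
  set D₂ : VariableChange R := ⟨u, 0, 0, 0⟩ with hD₂
  set I₂ := D₂ • I₁ with hI₂
  have h2a₁ : I₂.a₁ = 1 := by
    simp only [hI₂, hD₂, variableChange_a₁, mul_zero, add_zero, ← huval, Units.inv_mul]
  have h2a₂ : I₂.a₂ ∈ maximalIdeal R := by
    simp only [hI₂, hD₂, variableChange_a₂, zero_mul, sub_zero, mul_zero, add_zero,
      zero_pow two_ne_zero]
    exact Ideal.mul_mem_left _ _ h1a₂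
  have h2a₃ : I₂.a₃ ∈ maximalIdeal R := by
    simp only [hI₂, hD₂, variableChange_a₃, zero_mul, add_zero, mul_zero]
    exact Ideal.mul_mem_left _ _ h1a₃
  have h2a₄ : I₂.a₄ ∈ maximalIdeal R := by
    simp only [hI₂, hD₂, variableChange_a₄, zero_mul, sub_zero, mul_zero, add_zero,
      zero_pow two_ne_zero]
    exact Ideal.mul_mem_left _ _ h1a₄
  have h2a₆ : I₂.a₆ ∈ maximalIdeal R := by
    simp only [hI₂, hD₂, variableChange_a₆, zero_mul, add_zero, mul_zero, sub_zero,
      zero_pow two_ne_zero, zero_pow three_ne_zero]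
    exact Ideal.mul_mem_left _ _ h1a₆
  -- Step 3: kill `a₃` and `a₄` (non-monic Hensel)
  have h3a₃sq : 3 * I₂.a₃ ^ 2 ∈ maximalIdeal R :=
    Ideal.mul_mem_left _ _ (by rw [sq]; exact Ideal.mul_mem_left _ _ h2a₃)
  set g : R[X] := C 12 * X ^ 2 + C (12 * I₂.a₃ - 4 * I₂.a₂ - 1) * X +
    C (I₂.a₄ - 2 * I₂.a₂ * I₂.a₃ + 3 * I₂.a₃ ^ 2) with hg
  have hgeval : ∀ x : R, g.eval x = 12 * x ^ 2 + (12 * I₂.a₃ - 4 * I₂.a₂ - 1) * x +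
      (I₂.a₄ - 2 * I₂.a₂ * I₂.a₃ + 3 * I₂.a₃ ^ 2) := by
    intro x
    simp only [hg, eval_add, eval_mul, eval_C, eval_pow, eval_X]
  have hg0 : g.eval 0 ∈ maximalIdeal R := by
    rw [hgeval]
    simp only [zero_pow two_ne_zero, mul_zero, zero_add]
    exact Ideal.add_mem _ (Ideal.sub_mem _ h2a₄ (Ideal.mul_mem_left _ _ h2a₃)) h3a₃sq
  have hg0' : IsUnit (g.derivative.eval 0) := by
    have e : g.derivative.eval 0 = -(1 - (12 * I₂.a₃ - 4 * I₂.a₂)) := by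
      rw [← coeff_zero_eq_eval_zero, coeff_derivative]
      simp only [hg, coeff_add, coeff_C_mul, coeff_X_pow, coeff_X, coeff_C, zero_add,
        Nat.cast_zero]
      norm_num
    rw [e, IsUnit.neg_iff]
    refine isUnit_one_sub_self_of_mem_nonunits _ ((mem_maximalIdeal _).mp ?_)
    exact Ideal.sub_mem _ (Ideal.mul_mem_left _ _ h2a₃) (Ideal.mul_mem_left _ _ h2a₂)
  obtain ⟨t₃, hgt, ht₃⟩ := HenselianLocalRing.exists_isRoot_of_isUnit_derivative g 0 hg0 hg0'
  rw [sub_zero] at ht₃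
  have hgt' : 12 * t₃ ^ 2 + (12 * I₂.a₃ - 4 * I₂.a₂ - 1) * t₃ +
      (I₂.a₄ - 2 * I₂.a₂ * I₂.a₃ + 3 * I₂.a₃ ^ 2) = 0 := by
    rw [← hgeval]; exact hgt
  set r₃ : R := -I₂.a₃ - 2 * t₃ with hr₃
  have hr₃m : r₃ ∈ maximalIdeal R :=
    Ideal.sub_mem _ (Ideal.neg_mem_iff _ |>.mpr h2a₃) (Ideal.mul_mem_left _ _ ht₃)
  set D₃ : VariableChange R := ⟨1, r₃, 0, t₃⟩ with hD₃
  set I₃ := D₃ • I₂ with hI₃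
  have h3a₁ : I₃.a₁ = 1 := by
    simp only [hI₃, hD₃, variableChange_a₁, inv_one, Units.val_one, one_mul, mul_zero, add_zero,
      h2a₁]
  have h3a₂ : I₃.a₂ ∈ maximalIdeal R := by
    have e : I₃.a₂ = I₂.a₂ + 3 * r₃ := by
      simp only [hI₃, hD₃, variableChange_a₂, inv_one, Units.val_one, one_pow, one_mul, zero_mul,
        sub_zero, zero_pow two_ne_zero]
    rw [e]
    exact Ideal.add_mem _ h2a₂ (Ideal.mul_mem_left _ _ hr₃m)
  have h3a₃ : I₃.a₃ = 0 := by
    simp only [hI₃, hD₃, variableChange_a₃, inv_one, Units.val_one, one_pow, one_mul, h2a₁,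
      mul_one, hr₃]
    ring
  have h3a₄ : I₃.a₄ = 0 := by
    simp only [hI₃, hD₃, variableChange_a₄, inv_one, Units.val_one, one_pow, one_mul, zero_mul,
      sub_zero, mul_zero, add_zero, h2a₁, mul_one, hr₃]
    linear_combination hgt'
  have h3a₆ : I₃.a₆ ∈ maximalIdeal R := by
    have e : I₃.a₆ = I₂.a₆ + r₃ * I₂.a₄ + r₃ ^ 2 * I₂.a₂ + r₃ ^ 3 - t₃ * I₂.a₃ - t₃ ^ 2
        - r₃ * t₃ := by
      simp only [hI₃, hD₃, variableChange_a₆, inv_one, Units.val_one, one_pow, one_mul, h2a₁,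
        mul_one]
    rw [e]
    refine Ideal.sub_mem _ (Ideal.sub_mem _ (Ideal.sub_mem _ (Ideal.add_mem _ (Ideal.add_mem _
      (Ideal.add_mem _ h2a₆ (Ideal.mul_mem_left _ _ h2a₄)) (Ideal.mul_mem_left _ _ h2a₂))
      (Ideal.pow_mem_of_mem _ hr₃m 3 (by norm_num))) (Ideal.mul_mem_left _ _ h2a₃))
      (Ideal.pow_mem_of_mem _ ht₃ 2 (by norm_num))) (Ideal.mul_mem_left _ _ ht₃)
  -- Step 4: kill `a₂` (monic Hensel for `s² + s − a₂`)
  set h : R[X] := X ^ 2 + C 1 * X + C (-I₃.a₂) with hh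
  have hheval : ∀ x : R, h.eval x = x ^ 2 + x - I₃.a₂ := by
    intro x
    simp only [hh, eval_add, eval_mul, eval_C, eval_pow, eval_X, one_mul]
    ring
  have hhmonic : h.Monic := by
    rw [hh]
    monicity!
  have hh0 : h.eval 0 ∈ maximalIdeal R := by
    rw [hheval, zero_pow two_ne_zero, zero_add, zero_sub]
    exact (Ideal.neg_mem_iff _).mpr h3a₂
  have hh0' : IsUnit (h.derivative.eval 0) := by
    have e : h.derivative.eval 0 = 1 := by
      rw [← coeff_zero_eq_eval_zero, coeff_derivative]
      simp only [hh, coeff_add, coeff_C_mul, coeff_X_pow, coeff_X, coeff_C, zero_add,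
        Nat.cast_zero]
      norm_num
    rw [e]
    exact isUnit_one
  obtain ⟨s₄, hhs, hs₄⟩ := HenselianLocalRing.is_henselian h hhmonic 0 hh0 hh0'
  rw [sub_zero] at hs₄
  have hhs' : s₄ ^ 2 + s₄ - I₃.a₂ = 0 := by rw [← hheval]; exact hhs
  set D₄ : VariableChange R := ⟨1, 0, s₄, 0⟩ with hD₄
  set I₄ := D₄ • I₃ with hI₄
  have h4a₁ : I₄.a₁ = 1 + 2 * s₄ := by
    simp only [hI₄, hD₄, variableChange_a₁, inv_one, Units.val_one, one_mul, h3a₁]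
  have h4a₂ : I₄.a₂ = 0 := by
    simp only [hI₄, hD₄, variableChange_a₂, inv_one, Units.val_one, one_pow, one_mul, h3a₁,
      mul_one, mul_zero, add_zero]
    linear_combination -hhs'
  have h4a₃ : I₄.a₃ = 0 := by
    simp only [hI₄, hD₄, variableChange_a₃, inv_one, Units.val_one, one_pow, h3a₃, zero_mul,
      mul_zero, add_zero]
  have h4a₄ : I₄.a₄ = 0 := by
    simp only [hI₄, hD₄, variableChange_a₄, inv_one, Units.val_one, one_pow, h3a₃, h3a₄,
      mul_zero, sub_zero, zero_mul, add_zero, zero_pow two_ne_zero, h3a₁, mul_one]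
  have h4a₆ : I₄.a₆ = I₃.a₆ := by
    simp only [hI₄, hD₄, variableChange_a₆, inv_one, Units.val_one, one_pow, one_mul, h3a₃,
      zero_mul, add_zero, mul_zero, sub_zero, zero_pow two_ne_zero, zero_pow three_ne_zero]
  -- Step 5: rescale by the unit `1 + 2 s₄`
  have h5u : IsUnit (1 + 2 * s₄) := by
    refine isUnit_of_mem_nonunits_one_sub_self _ ((mem_maximalIdeal _).mp ?_)
    rw [sub_add_cancel_left]
    exact (Ideal.neg_mem_iff _).mpr (Ideal.mul_mem_left _ _ hs₄)
  set u₅ : Rˣ := h5u.unit with hu₅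
  have hu₅val : (u₅ : R) = 1 + 2 * s₄ := h5u.unit_spec
  set D₅ : VariableChange R := ⟨u₅, 0, 0, 0⟩ with hD₅
  refine ⟨D₅ * D₄ * D₃ * D₂ * D₁, ?_, ?_, ?_, ?_, ?_⟩
  all_goals rw [mul_smul, mul_smul, mul_smul, mul_smul, ← hI₁, ← hI₂, ← hI₃, ← hI₄]
  · simp only [hD₅, variableChange_a₁, mul_zero, add_zero, h4a₁, ← hu₅val, Units.inv_mul]
  · simp only [hD₅, variableChange_a₂, h4a₂, h4a₁, zero_mul, sub_zero, mul_zero, add_zero,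
      zero_pow two_ne_zero]
  · simp only [hD₅, variableChange_a₃, h4a₃, zero_mul, add_zero, mul_zero]
  · simp only [hD₅, variableChange_a₄, h4a₄, h4a₃, zero_mul, mul_zero, add_zero,
      zero_pow two_ne_zero, sub_self]
  · simp only [hD₅, variableChange_a₆, h4a₆, h4a₃, zero_mul, add_zero, mul_zero, sub_zero,
      zero_pow two_ne_zero, zero_pow three_ne_zero]
    exact Ideal.mul_mem_left _ _ h3a₆

end Henselian

/-! ### Part 3 — the local minimal model at a place of split multiplicative reduction -/

section TateNormalFormΔ

variable {S : Type*} [CommRing S] (T : WeierstrassCurve S)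

/-- The discriminant of `y² + xy = x³ + a₆` is `Δ = −a₆ (1 + 432 a₆)` (`b₂ = 1`, `b₄ = 0`,
`b₆ = 4a₆`, `b₈ = a₆`; Silverman, *ATAEC*, V.3, the computation `Δ = q ∏ (1 − qⁿ)²⁴` starts
from this shape). [folklore] -/
theorem Δ_eq_of_tateNormalForm (h1 : T.a₁ = 1) (h2 : T.a₂ = 0) (h3 : T.a₃ = 0) (h4 : T.a₄ = 0) :
    T.Δ = -(T.a₆ * (1 + 432 * T.a₆)) := by
  simp only [Δ, b₂, b₄, b₆, b₈, h1, h2, h3, h4]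
  ring

/-- `c₄ = 1` for `y² + xy = x³ + a₆`. [folklore] -/
theorem c₄_eq_of_tateNormalForm (h1 : T.a₁ = 1) (h2 : T.a₂ = 0) (h3 : T.a₃ = 0) (h4 : T.a₄ = 0) :
    T.c₄ = 1 := by
  simp only [c₄, b₂, b₄, h1, h2, h3, h4]
  ring

end TateNormalFormΔ

section Local

open IsDedekindDomain IsLocalRing IsDiscreteValuationRing Polynomial

variable {A : Type*} [CommRing A] [IsDedekindDomain A] {K : Type*} [Field K] [Algebra A K]
  [IsFractionRing A K] (v : HeightOneSpectrum A) (W : WeierstrassCurve K)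

/-- **The integral local minimal model at a place of split multiplicative reduction, in Tate
normal form.** Let `W` be an elliptic curve over the fraction field `K` of a Dedekind domain
with split multiplicative reduction at the finite place `v`, `I = W.localMinimalIntegralModel v`
the integral model over `O_v` of its chosen minimal model and `ϖ` a uniformiser of `O_v`. Then
there is a change of variables `D` over `O_v` (`u ∈ O_vˣ`, `r, s, t ∈ O_v`) with
`D • I = (y² + xy = x³ + αϖⁿ)`, `α ∈ O_vˣ`, `n = ord_v(Δ_min) ≥ 1`
(`WeierstrassCurve.ordMinimalDiscriminant`). Indeed `O_v` is Henselian
(`adicCompletionIntegers.henselianLocalRing`), so `exists_variableChange_eq_tateNormalForm`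
applies to `I`; the new equation `y² + xy = x³ + a` has `Δ = −a(1 + 432a)` with
`1 + 432a ∈ O_vˣ`, and `u ∈ O_vˣ` does not change `ord_v(Δ)`, so `ord_v(a) = ord_v(Δ_min)`.
This is the shape of the Tate curve `E_q : y² + xy = x³ + a₄x + a₆`, `v(Δ) = v(q)`, Silverman,
*ATAEC*, V.3.1 and Rem. IV.9.6, reached here by elementary changes of variables instead of
`q`-expansions. [cite: SilvermanATAEC1994, IV.9.4 Step 2 (PDF p. 344) and Rem. IV.9.6 (PDF p. 355)] -/
theorem exists_variableChange_localMinimalIntegralModel_eq_tateNormalForm [W.IsElliptic]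
    (h : W.HasSplitMultiplicativeReductionAt v) {ϖ : v.adicCompletionIntegers K}
    (hϖ : Irreducible ϖ) :
    ∃ (D : VariableChange (v.adicCompletionIntegers K)) (α : (v.adicCompletionIntegers K)ˣ),
      1 ≤ W.ordMinimalDiscriminant v ∧
      D • W.localMinimalIntegralModel v =
        ⟨1, 0, 0, 0, (α : v.adicCompletionIntegers K) * ϖ ^ W.ordMinimalDiscriminant v⟩ := by
  set R := v.adicCompletionIntegers K with hR
  set I : WeierstrassCurve R := W.localMinimalIntegralModel v with hI
  obtain ⟨hΔm, hc₄m⟩ := (hasMultiplicativeReductionAt_iff_mem v W).mp h.hasMultiplicativeReductionAt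
  -- a rational tangent slope at the node
  have hsplit : ∃ μ : ResidueField R, letI Ib := I.map (residue R);
      Ib.c₄ * μ ^ 2 + Ib.a₁ * Ib.c₄ * μ - (54 * Ib.b₆ - 3 * Ib.b₂ * Ib.b₄ + Ib.a₂ * Ib.c₄) = 0 := by
    have hs := h.splitMultiplicativeReduction
    have hc₄b : residue R I.c₄ ≠ 0 := by rw [Ne, residue_eq_zero_iff]; exact hc₄m
    have hdeg : degree (Polynomial.map (algebraMap R (ResidueField R))
        (C I.c₄ * X ^ 2 + C (I.a₁ * I.c₄) * X
          - C (54 * I.b₆ - 3 * I.b₂ * I.b₄ + I.a₂ * I.c₄))) ≠ 0 := by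
      rw [Polynomial.map_sub, Polynomial.map_add, Polynomial.map_mul, Polynomial.map_mul,
        Polynomial.map_pow, map_C, map_C, map_C, Polynomial.map_X, sub_eq_add_neg, ← C_neg,
        ResidueField.algebraMap_eq, degree_quadratic hc₄b]
      decide
    obtain ⟨μ, hμ⟩ := hs.exists_eval_eq_zero hdeg
    refine ⟨μ, ?_⟩
    rw [eval_map, ResidueField.algebraMap_eq] at hμ
    simp only [eval₂_sub, eval₂_add, eval₂_mul, eval₂_C, eval₂_X, eval₂_pow, eval₂_ofNat,
      map_mul, map_sub, map_add, map_ofNat] at hμ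
    simp only [map_c₄, map_a₁, map_a₂, map_b₂, map_b₄, map_b₆]
    exact hμ
  -- Tate normal form over the Henselian ring `O_v`
  obtain ⟨D, h1, h2, h3, h4, h6⟩ := I.exists_variableChange_eq_tateNormalForm hΔm hc₄m hsplit
  set a : R := (D • I).a₆ with ha
  have hIΔ : I.Δ ≠ 0 := by
    intro h0
    haveI := W.isElliptic_localMinimalModel v
    apply (W.localMinimalModel v).isUnit_Δ.ne_zero
    rw [← integralModel_Δ_eq R (W.localMinimalModel v)]
    change algebraMap R _ I.Δ = 0
    rw [h0, map_zero]
  have hTΔ : (D • I).Δ = -(a * (1 + 432 * a)) := Δ_eq_of_tateNormalForm _ h1 h2 h3 h4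
  have hTΔ' : (D • I).Δ = ((D.u⁻¹ : Rˣ) : R) ^ 12 * I.Δ := variableChange_Δ _ _
  have hu432 : IsUnit (1 + 432 * a) := by
    refine isUnit_of_mem_nonunits_one_sub_self _ ((mem_maximalIdeal _).mp ?_)
    rw [sub_add_cancel_left]
    exact (Ideal.neg_mem_iff _).mpr (Ideal.mul_mem_left _ _ h6)
  have ha0 : a ≠ 0 := by
    intro h0
    apply hIΔ
    have e : ((D.u⁻¹ : Rˣ) : R) ^ 12 * I.Δ = 0 := by rw [← hTΔ', hTΔ, h0, zero_mul, neg_zero]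
    exact ((D.u⁻¹.isUnit.pow 12).mul_right_eq_zero).mp e
  -- `ord (a) = ord (Δ (I)) = ord_v (Δ_min)`
  have hval : addVal R a = addVal R I.Δ := by
    have e1 : addVal R (D • I).Δ = addVal R I.Δ := by
      rw [hTΔ', addVal_mul, addVal_pow, addVal_eq_zero_iff.mpr D.u⁻¹.isUnit, nsmul_zero,
        zero_add]
    have e2 : addVal R (D • I).Δ = addVal R a := by
      rw [hTΔ, ← neg_one_mul, addVal_mul, addVal_mul, addVal_eq_zero_iff.mpr isUnit_one.neg,
        zero_add, addVal_eq_zero_iff.mpr hu432, add_zero]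
    rw [← e2, e1]
  obtain ⟨n, α, hα⟩ := eq_unit_mul_pow_irreducible ha0 hϖ
  have hn : W.ordMinimalDiscriminant v = n := by
    change (addVal R I.Δ).toNat = n
    rw [← hval, hα, addVal_def' α hϖ n]
    rfl
  have hn1 : 1 ≤ n := by
    rcases Nat.eq_zero_or_pos n with h0 | hpos
    · exfalso
      rw [h0, pow_zero, mul_one] at hα
      rw [hα] at h6
      exact (mem_nonunits_iff.mp ((mem_maximalIdeal _).mp h6)) α.isUnit
    · exact hpos
  refine ⟨D, α, hn ▸ hn1, ?_⟩
  rw [hn]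
  exact WeierstrassCurve.ext h1 h2 h3 h4 (by rw [← ha, hα])

/-- **The local minimal model at a place of split multiplicative reduction, in Tate normal
form** (`K_v`-version of `exists_variableChange_localMinimalIntegralModel_eq_tateNormalForm`):
`D • (W.localMinimalModel v) = (y² + xy = x³ + αϖⁿ)` over `K_v` with `D` over `O_v`,
`α ∈ O_vˣ`, `n = ord_v(Δ_min) ≥ 1`. [cite: SilvermanATAEC1994, IV.9.4 Step 2 (PDF p. 344) and Rem. IV.9.6 (PDF p. 355)] -/
theorem exists_variableChange_localMinimalModel_eq_tateNormalForm [W.IsElliptic]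
    (h : W.HasSplitMultiplicativeReductionAt v) {ϖ : v.adicCompletionIntegers K}
    (hϖ : Irreducible ϖ) :
    ∃ (D : VariableChange (v.adicCompletionIntegers K)) (α : (v.adicCompletionIntegers K)ˣ),
      1 ≤ W.ordMinimalDiscriminant v ∧
      D • W.localMinimalIntegralModel v =
        ⟨1, 0, 0, 0, (α : v.adicCompletionIntegers K) * ϖ ^ W.ordMinimalDiscriminant v⟩ ∧
      D.baseChange (v.adicCompletion K) • W.localMinimalModel v =
        ⟨1, 0, 0, 0, algebraMap (v.adicCompletionIntegers K) (v.adicCompletion K)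
          ((α : v.adicCompletionIntegers K) * ϖ ^ W.ordMinimalDiscriminant v)⟩ := by
  obtain ⟨D, α, hn1, hD⟩ :=
    W.exists_variableChange_localMinimalIntegralModel_eq_tateNormalForm v h hϖ
  refine ⟨D, α, hn1, hD, ?_⟩
  have hM : (W.localMinimalIntegralModel v).baseChange (v.adicCompletion K) =
      W.localMinimalModel v :=
    baseChange_integralModel_eq (v.adicCompletionIntegers K) (W.localMinimalModel v)
  rw [← hM, baseChange, VariableChange.baseChange, map_variableChange, hD]
  ext <;> simp [map]

end Local

end WeierstrassCurve

end
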